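import Mathlib.Analysis.SpecialFunctions.Pow.Real
import HarnessLib

/-!
# T⁴ programme, node NE3 — census R50 open half (M1), TWELFTH BRICK: the DISPLACEMENT RECURSION of the twisted tower, solved — `b_{j+1} ≤ A·b_j + C_j`, `b₀ = 0` ⟹
# `b_k ≤ Σ_{j<k} A^{k−1−j}·C_j` (discrete Gronwall) (`FrameNormalisationTowerRecursion`)

Cell `pub-balaban-gaps` (track G2, seat ne3, generation 11), row NE3; census `HOME/ne/NE3.md` §4 R50, §17 (M1).  Along the twisted tower (`FrameNormalisationTower` ∕ `…TowerExists`)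
the displacement `b_j := sup ‖Dʲ − U̿′ʲ‖` of the twisted double-bar tower from the exact one obeys a one-step recursion `b_{j+1} ≤ A·b_j + C_j` — `A` from the Lipschitz property of the
one-step average in the configuration ([Balaban1985Averaging] Prop. 7; `B7Eq65AverageLipschitz`) and of the framed product (`FrameNormalisationDefectSizeJoint.norm_framed_sub_framed_le₃`),
`C_j` the twist letter of level `j` (`FrameNormalisationDefectSize`, `…Oscillation[Tree]`) — with `b₀ = 0` (`D⁰ = U′`).  This module solves the recursion (elementary real analysis;
the instantiation with the regime letters is the contraction's bookkeeping, NOT done here):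

* **`le_sum_pow_mul_of_rec`** — `0 ≤ A`, `b₀ ≤ 0`, `b_{j+1} ≤ A·b_j + C_j` for all `j` ⟹ `b_k ≤ Σ_{j<k} A^{k−1−j}·C_j` for all `k`.
* `le_mul_of_rec` ∕ `le_div_of_rec` — with `0 ≤ C_j ≤ C`: `b_k ≤ k·C` for `A ≤ 1`, and the LEVEL-FREE `b_k ≤ C∕(1 − A)` for `A < 1` (geometric sum).

HONEST FRAMING (page 1).  Real-number bookkeeping (0 def, 0 sorry); nothing of Bałaban's asserted; **NE3 NOT proved**; `PairLandauGaugeB8Avg` and the covariant root NOT proved; spine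
PROVED 0∕9; finite T⁴ rung (B)+1 — NOT continuum YM on ℝ⁴, NOT infinite volume, NOT mass gap, NOT `BetaPertH`, NOT Clay.  HONEST DEPENDENCY: continuum YM on T⁴ ⇐ BetaPertH ∧ nine
spine estimates (0/9 proved); BetaPertH ⇐ (D1) ∧ (D4) ∧ CAP+tail; G-an2-4 gates asym, D1 and NE2/3/4.  PLACEMENT: `Summits/QuantumFields/BalabanUV/T4Continuum/Spine/NE3/`; Mathlib only.

References: [Balaban1985Averaging] T. Bałaban, *Averaging operations for lattice gauge theories*, CMP 98 (1985) 17–51: Prop. 7 p. 43, (160)–(163) p. 42.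
-/

set_option autoImplicit false

open scoped BigOperators

namespace Summit.QuantumFields.BalabanUV.T4Continuum.NE3.FrameNormalisationTowerRecursion

/-- **DISCRETE GRONWALL FOR THE TOWER DISPLACEMENT**: `0 ≤ A`, `b₀ ≤ 0`, `b_{j+1} ≤ A·b_j + C_j` ⟹ `b_k ≤ Σ_{j<k} A^{k−1−j}·C_j`. [folklore] -/
theorem le_sum_pow_mul_of_rec {b C : ℕ → ℝ} {A : ℝ} (hA : 0 ≤ A) (hb0 : b 0 ≤ 0) (hrec : ∀ j : ℕ, b (j + 1) ≤ A * b j + C j) :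
    ∀ k : ℕ, b k ≤ ∑ j ∈ Finset.range k, A ^ (k - 1 - j) * C j
  | 0 => by simpa using hb0
  | k + 1 => by
    have ih := le_sum_pow_mul_of_rec hA hb0 hrec k
    calc b (k + 1) ≤ A * b k + C k := hrec k
      _ ≤ A * (∑ j ∈ Finset.range k, A ^ (k - 1 - j) * C j) + C k := by gcongr
      _ = ∑ j ∈ Finset.range (k + 1), A ^ (k + 1 - 1 - j) * C j := by
          rw [Finset.sum_range_succ, Finset.mul_sum]
          congr 1
          · refine Finset.sum_congr rfl fun j hj => ?_
            have hj' : j < k := Finset.mem_range.mp hj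
            have : k + 1 - 1 - j = (k - 1 - j) + 1 := by omega
            rw [this, pow_succ]; ring
          · simp

/-- **UNIFORM TWIST LETTER, NON-EXPANSIVE STEP**: with `0 ≤ C_j ≤ C` and `A ≤ 1`, `b_k ≤ k·C` (level-free form next). [folklore] -/
theorem le_mul_of_rec {b Cs : ℕ → ℝ} {A C : ℝ} (hA : 0 ≤ A) (hA1 : A ≤ 1) (hb0 : b 0 ≤ 0) (hrec : ∀ j : ℕ, b (j + 1) ≤ A * b j + Cs j)
    (hCs0 : ∀ j : ℕ, 0 ≤ Cs j) (hCs : ∀ j : ℕ, Cs j ≤ C) (k : ℕ) : b k ≤ k * C := by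
  refine (le_sum_pow_mul_of_rec hA hb0 hrec k).trans ?_
  calc ∑ j ∈ Finset.range k, A ^ (k - 1 - j) * Cs j ≤ ∑ j ∈ Finset.range k, (1 : ℝ) * C :=
        Finset.sum_le_sum fun j _ => mul_le_mul (pow_le_one₀ hA hA1) (hCs j) (hCs0 j) zero_le_one
    _ = k * C := by simp [Finset.sum_const, Finset.card_range]


/-- **UNIFORM TWIST LETTER, CONTRACTIVE STEP** (`0 ≤ A < 1`, `0 ≤ C_j ≤ C`): the level-free bound `b_k ≤ C ∕ (1 − A)` (geometric sum). [folklore] -/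
theorem le_div_of_rec {b Cs : ℕ → ℝ} {A C : ℝ} (hA : 0 ≤ A) (hA1 : A < 1) (hb0 : b 0 ≤ 0) (hrec : ∀ j : ℕ, b (j + 1) ≤ A * b j + Cs j)
    (hCs0 : ∀ j : ℕ, 0 ≤ Cs j) (hCs : ∀ j : ℕ, Cs j ≤ C) (k : ℕ) : b k ≤ C / (1 - A) := by
  have hC : 0 ≤ C := (hCs0 0).trans (hCs 0)
  refine (le_sum_pow_mul_of_rec hA hb0 hrec k).trans ?_
  have h1 : ∑ j ∈ Finset.range k, A ^ (k - 1 - j) * Cs j ≤ ∑ j ∈ Finset.range k, A ^ (k - 1 - j) * C :=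
    Finset.sum_le_sum fun j _ => mul_le_mul_of_nonneg_left (hCs j) (pow_nonneg hA _)
  refine h1.trans ?_
  rw [← Finset.sum_mul, Finset.sum_range_reflect (fun i => A ^ i) k, geom_sum_eq hA1.ne k]
  -- `(A^k − 1)/(A − 1) · C ≤ C/(1 − A)`
  have hden : 0 < 1 - A := by linarith
  have hAk : 0 ≤ A ^ k := pow_nonneg hA k
  rw [show (A ^ k - 1) / (A - 1) = (1 - A ^ k) / (1 - A) by
    rw [← neg_sub 1 (A ^ k), ← neg_sub 1 A, neg_div_neg_eq], div_mul_eq_mul_div, div_le_div_iff_of_pos_right hden]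
  nlinarith

end Summit.QuantumFields.BalabanUV.T4Continuum.NE3.FrameNormalisationTowerRecursion
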